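import Summits.Schanuel.Schanuel.Theorems.ZilberEacParamCurveRayRootsRem
import Summits.Schanuel.Schanuel.Theorems.ZilberEacParamFibreCurveGap
import Summits.Schanuel.Schanuel.Theorems.ZilberEacParamSurfaceCurvedReal
import HarnessLib

/-!
# Polynomially parametrised base curves, XLV: two estimates for NON-SPLIT `Q` over an
# equal-degree curve with real leading ratio (off-edge part; value datum near a root)

HONEST FRAMING.  Cell `pub-schanuel` (Zilber's Exponential-Algebraic Closedness, case ladder;
host summit Schanuel), seat 2, gen 21.  Gen 20 (file XXXV) decided non-split surfaces over CURVED
real lines: `deg g₀ = deg g₁ = n`, `λ = lc(g₁)/lc(g₀) ∈ ℝ ∖ ℚ`, and `lc(g₀)(g₁)_{n-1} ≠ lc(g₁)(g₀)_{n-1}`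
(the decay of `e^{g₀}` along the balance roots of `R_s = g₁ + s g₀` came from the sub-leading
order).  Here the curvature condition is replaced by the mere non-linearity of the base:
`D = lc(g₀) g₁ - lc(g₁) g₀` non-constant.  Writing `g₀ = R_s/(λ+s) - D/((λ+s) lc(g₀))`, the decay
of `e^{g₀}` on the small discs around the roots is governed by the lower-order polynomial
`D' = -D/((λ+s) lc(g₀))` (root package of file XLIV, engine of file XXXIII with `G = D'` and the
off-edge estimate `norm_offEdgeSum₃_le_log₃`, which tolerates `Re g₀ ≤ A log ‖t‖ + B + Re D'`), and
the growth of `|Re g₀|` along the zeros is the Puiseux-gap lemma of file XXXIX with `e = 1`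
(`Re(c i) = 0` for the REAL `c = 1/(λ+s)`), fed by the value datum recovered from the distance to
the roots (`abs_re_sub_log_le_of_near_root`).  This file: the two estimates; the zeros are
produced in file XLVI (`exists_paramSurface_expPoints_of_realRatio`).
Mantova–Masser's question is OPEN in general (PLMS 2024 §1 p. 5); NOT Schanuel's conjecture
(neither used nor implied; EAC ⇏ SC); `EC(3,2)` stays OPEN.
-/

noncomputable section

open Filter Topology Metric Set Complex MvPolynomial
open Literature.NumberTheory.Transcendental Literature.ModelTheory.Zilber
open Literature.ModelTheory.ExponentialFields

set_option linter.dupNamespace false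

namespace Summit.Schanuel.Schanuel.Theorems

/-! ## Part A. Two estimates -/

section EdgeSum

variable {P : MvPolynomial (Fin 3) ℂ} {s : ℝ} {mb : Fin 3 →₀ ℕ}

/-- **The off-edge part in the window `|Re(x₁ + s x₀) - μ log ‖t‖| ≤ B` when
`Re x₀ ≤ A log ‖t‖ + B₀ + y` with `y ≤ 0`** (`‖t‖ ≥ 1`, weights in `[δ, W]`, `δ > 0`):
`‖E‖ ≤ C (1 + ‖t‖)^{N + N' + N''} e^{δ y}`. (new) -/
theorem norm_offEdgeSum₃_le_log₃ {δ B μ A B₀ y W : ℝ} {N N' N'' : ℕ} (hδ0 : 0 < δ)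
    (hδ : ∀ m ∈ P.support, ¬ ((m 1 : ℝ) - s * m 2) = (mb 1 : ℝ) - s * mb 2 →
      δ ≤ ((m 1 : ℝ) - s * m 2) - ((mb 1 : ℝ) - s * mb 2))
    (hW : ∀ m ∈ P.support, ((m 1 : ℝ) - s * m 2) - ((mb 1 : ℝ) - s * mb 2) ≤ W)
    (hN : ∀ m ∈ P.support, m 0 ≤ N)
    (hN' : ∀ m ∈ P.support, |(m 2 : ℝ) - mb 2| * |μ| ≤ N') (hA : 0 ≤ A) (hN'' : W * A ≤ N'')
    {t x₀ x₁ : ℂ} (hy : y ≤ 0) (hz : x₀.re ≤ A * Real.log ‖t‖ + B₀ + y) (hz1 : 1 ≤ ‖t‖)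
    (hB : |(x₁ + (s : ℂ) * x₀).re - μ * Real.log ‖t‖| ≤ B) :
    ‖∑ m ∈ P.support.filter
          (fun m : Fin 3 →₀ ℕ => ¬ ((m 1 : ℝ) - s * m 2) = (mb 1 : ℝ) - s * mb 2),
        P.coeff m * t ^ (m 0) *
          exp ((((m 1 : ℝ) - s * m 2 - ((mb 1 : ℝ) - s * mb 2) : ℝ) : ℂ) * x₀ +
            (((m 2 : ℝ) - mb 2 : ℝ) : ℂ) * (x₁ + (s : ℂ) * x₀))‖ ≤
      (∑ m ∈ P.support.filter
          (fun m : Fin 3 →₀ ℕ => ¬ ((m 1 : ℝ) - s * m 2) = (mb 1 : ℝ) - s * mb 2),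
          ‖P.coeff m‖ * Real.exp (|(m 2 : ℝ) - mb 2| * B) * Real.exp (W * |B₀|)) *
        (1 + ‖t‖) ^ (N + N' + N'') * Real.exp (δ * y) := by
  classical
  set R₀z := x₁ + (s : ℂ) * x₀ with hR₀
  rw [Finset.sum_mul, Finset.sum_mul]
  refine (norm_sum_le _ _).trans (Finset.sum_le_sum fun m hm => ?_)
  obtain ⟨hmA, hmw⟩ := Finset.mem_filter.1 hm
  rw [norm_mul, norm_mul, norm_pow, Complex.norm_exp, Complex.add_re, Complex.re_ofReal_mul,
    Complex.re_ofReal_mul]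
  have hlog0 : 0 ≤ Real.log ‖t‖ := Real.log_nonneg hz1
  set w : ℝ := (m 1 : ℝ) - s * m 2 - ((mb 1 : ℝ) - s * mb 2) with hw_def
  have hwδ : δ ≤ w := hδ m hmA hmw
  have hwW : w ≤ W := hW m hmA
  have hw0 : 0 ≤ w := hδ0.le.trans hwδ
  have hWnn : 0 ≤ W := hw0.trans hwW
  -- `w Re x₀ ≤ W A log ‖t‖ + W |B₀| + δ y`
  have h1 : w * x₀.re ≤ W * A * Real.log ‖t‖ + W * |B₀| + δ * y := by
    calc w * x₀.re ≤ w * (A * Real.log ‖t‖ + B₀ + y) := mul_le_mul_of_nonneg_left hz hw0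
      _ = w * A * Real.log ‖t‖ + w * B₀ + w * y := by ring
      _ ≤ W * A * Real.log ‖t‖ + W * |B₀| + δ * y := by
          refine add_le_add (add_le_add ?_ ?_) ?_
          · exact mul_le_mul_of_nonneg_right (mul_le_mul_of_nonneg_right hwW hA) hlog0
          · calc w * B₀ ≤ |w * B₀| := le_abs_self _
              _ = |w| * |B₀| := abs_mul _ _
              _ ≤ W * |B₀| := by
                  rw [abs_of_nonneg hw0]
                  exact mul_le_mul_of_nonneg_right hwW (abs_nonneg _)
          · have : (w - δ) * y ≤ 0 := mul_nonpos_of_nonneg_of_nonpos (by linarith) hy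
            linarith
  -- `Δ Re R₀ ≤ |Δ| B + |Δ| |μ| log ‖t‖`
  have h2 : ((m 2 : ℝ) - mb 2) * R₀z.re ≤
      |(m 2 : ℝ) - mb 2| * B + |(m 2 : ℝ) - mb 2| * |μ| * Real.log ‖t‖ := by
    have e1 : ((m 2 : ℝ) - mb 2) * R₀z.re =
        ((m 2 : ℝ) - mb 2) * (R₀z.re - μ * Real.log ‖t‖) +
          ((m 2 : ℝ) - mb 2) * μ * Real.log ‖t‖ := by ring
    rw [e1]
    refine add_le_add ?_ ?_
    · refine (le_abs_self _).trans ?_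
      rw [abs_mul]
      exact mul_le_mul_of_nonneg_left hB (abs_nonneg _)
    · have : ((m 2 : ℝ) - mb 2) * μ ≤ |(m 2 : ℝ) - mb 2| * |μ| := by
        rw [← abs_mul]; exact le_abs_self _
      exact mul_le_mul_of_nonneg_right this hlog0
  have ht1 : 1 ≤ 1 + ‖t‖ := by linarith [norm_nonneg t]
  have hzN : ‖t‖ ^ (m 0) ≤ (1 + ‖t‖) ^ N :=
    (pow_le_pow_left₀ (norm_nonneg _) (by linarith [norm_nonneg t]) _).trans
      (pow_le_pow_right₀ ht1 (hN m hmA))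
  have hzN' : Real.exp (|(m 2 : ℝ) - mb 2| * |μ| * Real.log ‖t‖) ≤ (1 + ‖t‖) ^ N' :=
    exp_mul_log_le_pow (hN' m hmA) hz1 (by linarith)
  have hzN'' : Real.exp (W * A * Real.log ‖t‖) ≤ (1 + ‖t‖) ^ N'' :=
    exp_mul_log_le_pow hN'' hz1 (by linarith)
  have hexp : Real.exp (w * x₀.re + ((m 2 : ℝ) - mb 2) * R₀z.re) ≤
      Real.exp (|(m 2 : ℝ) - mb 2| * B) * Real.exp (W * |B₀|) * ((1 + ‖t‖) ^ N' *
        (1 + ‖t‖) ^ N'') * Real.exp (δ * y) := by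
    calc Real.exp (w * x₀.re + ((m 2 : ℝ) - mb 2) * R₀z.re)
        ≤ Real.exp ((|(m 2 : ℝ) - mb 2| * B + W * |B₀|) +
            (|(m 2 : ℝ) - mb 2| * |μ| * Real.log ‖t‖ + W * A * Real.log ‖t‖) + δ * y) :=
          Real.exp_le_exp.2 (by linarith)
      _ = Real.exp (|(m 2 : ℝ) - mb 2| * B) * Real.exp (W * |B₀|) *
            (Real.exp (|(m 2 : ℝ) - mb 2| * |μ| * Real.log ‖t‖) *
              Real.exp (W * A * Real.log ‖t‖)) * Real.exp (δ * y) := by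
          rw [Real.exp_add, Real.exp_add, Real.exp_add, Real.exp_add]
      _ ≤ Real.exp (|(m 2 : ℝ) - mb 2| * B) * Real.exp (W * |B₀|) * ((1 + ‖t‖) ^ N' *
            (1 + ‖t‖) ^ N'') * Real.exp (δ * y) := by
          gcongr
  calc ‖P.coeff m‖ * ‖t‖ ^ (m 0) * Real.exp (w * x₀.re + ((m 2 : ℝ) - mb 2) * R₀z.re)
      ≤ ‖P.coeff m‖ * (1 + ‖t‖) ^ N *
          (Real.exp (|(m 2 : ℝ) - mb 2| * B) * Real.exp (W * |B₀|) * ((1 + ‖t‖) ^ N' *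
            (1 + ‖t‖) ^ N'') * Real.exp (δ * y)) :=
        mul_le_mul (mul_le_mul_of_nonneg_left hzN (norm_nonneg _)) hexp (Real.exp_nonneg _)
          (by positivity)
    _ = ‖P.coeff m‖ * Real.exp (|(m 2 : ℝ) - mb 2| * B) * Real.exp (W * |B₀|) *
          (1 + ‖t‖) ^ (N + N' + N'') * Real.exp (δ * y) := by
        rw [pow_add, pow_add]; ring

end EdgeSum

/-- **The value datum near a root.**  `d = deg R ≥ 1`, `a = lc(R)`, `‖z₀‖ ≥ 2`,
`Re R(z₀) = L₀ + μ log ‖z₀‖`, `‖t - z₀‖ ≤ min(1, 2/(‖a‖ ‖z₀‖^{d-1}))` ⟹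
`|Re R(t) - μ log ‖t‖| ≤ |L₀| + (Σ|R_i|) d 2^d / ‖a‖ + |μ|`. (new) -/
theorem abs_re_sub_log_le_of_near_root (R : Polynomial ℂ) (hd : 1 ≤ R.natDegree) {z₀ t : ℂ}
    {L₀ μ : ℝ} (hz2 : 2 ≤ ‖z₀‖) (hre : (R.eval z₀).re = L₀ + μ * Real.log ‖z₀‖)
    (hdist1 : ‖t - z₀‖ ≤ 1)
    (hdist : ‖t - z₀‖ ≤ 2 / (‖R.leadingCoeff‖ * ‖z₀‖ ^ (R.natDegree - 1))) :
    |(R.eval t).re - μ * Real.log ‖t‖| ≤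
      |L₀| + coeffNormSum R * R.natDegree * 2 ^ R.natDegree / ‖R.leadingCoeff‖ + |μ| := by
  obtain ⟨d', hd'⟩ : ∃ d', R.natDegree = d' + 1 := ⟨R.natDegree - 1, by omega⟩
  have hR0 : R ≠ 0 := by rintro rfl; rw [Polynomial.natDegree_zero] at hd; omega
  have hapos : 0 < ‖R.leadingCoeff‖ := norm_pos_iff.2 (Polynomial.leadingCoeff_ne_zero.2 hR0)
  rw [hd', Nat.add_sub_cancel] at hdist
  have hzpos : 0 < ‖z₀‖ := by linarith
  -- Lipschitz on the disc of radius `2‖z₀‖`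
  set M : ℝ := 2 * ‖z₀‖ with hM
  have hM1 : 1 ≤ M := by rw [hM]; linarith
  have htM : ‖t‖ ≤ M := by
    have := norm_le_insert' t z₀; rw [hM]; linarith
  have hzM : ‖z₀‖ ≤ M := by rw [hM]; linarith
  have hlip := norm_eval_sub_eval_le R hM1 htM hzM (n := d') (by omega)
  have hK : coeffNormSum R * (d' + 1) * M ^ d' * ‖t - z₀‖ ≤
      coeffNormSum R * R.natDegree * 2 ^ R.natDegree / ‖R.leadingCoeff‖ := by
    have hC0 : 0 ≤ coeffNormSum R := coeffNormSum_nonneg R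
    have hzpow : 0 < ‖z₀‖ ^ d' := pow_pos hzpos _
    calc coeffNormSum R * (d' + 1) * M ^ d' * ‖t - z₀‖
        ≤ coeffNormSum R * (d' + 1) * M ^ d' * (2 / (‖R.leadingCoeff‖ * ‖z₀‖ ^ d')) :=
          mul_le_mul_of_nonneg_left hdist (by positivity)
      _ = coeffNormSum R * (d' + 1) * 2 ^ (d' + 1) / ‖R.leadingCoeff‖ := by
          rw [hM, mul_pow]; field_simp; ring
      _ = coeffNormSum R * R.natDegree * 2 ^ R.natDegree / ‖R.leadingCoeff‖ := by
          rw [hd']; push_cast; ring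
  have hdiff : |(R.eval t).re - (R.eval z₀).re| ≤
      coeffNormSum R * R.natDegree * 2 ^ R.natDegree / ‖R.leadingCoeff‖ := by
    rw [← Complex.sub_re]
    exact (Complex.abs_re_le_norm _).trans (hlip.trans hK)
  -- logarithms
  have hup : ‖t‖ ≤ 2 * ‖z₀‖ := htM
  have hlow : ‖z₀‖ / 2 ≤ ‖t‖ := by
    have := norm_sub_norm_le z₀ t
    rw [norm_sub_rev] at this; linarith
  have htpos : 0 < ‖t‖ := by linarith
  have hlog2 : Real.log 2 ≤ 1 := by
    have := Real.log_two_lt_d9; norm_num at this; linarith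
  have hlogup : Real.log ‖t‖ ≤ Real.log ‖z₀‖ + 1 := by
    have := Real.log_le_log htpos hup
    rw [Real.log_mul two_ne_zero hzpos.ne'] at this; linarith
  have hloglow : Real.log ‖z₀‖ - 1 ≤ Real.log ‖t‖ := by
    have := Real.log_le_log (by positivity) hlow
    rw [Real.log_div hzpos.ne' two_ne_zero] at this; linarith
  have hμ : |μ * Real.log ‖z₀‖ - μ * Real.log ‖t‖| ≤ |μ| := by
    rw [← mul_sub, abs_mul]
    calc |μ| * |Real.log ‖z₀‖ - Real.log ‖t‖| ≤ |μ| * 1 :=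
          mul_le_mul_of_nonneg_left (abs_le.2 ⟨by linarith, by linarith⟩) (abs_nonneg μ)
      _ = |μ| := mul_one _
  have hsplit : (R.eval t).re - μ * Real.log ‖t‖ = ((R.eval t).re - (R.eval z₀).re) + L₀ +
      (μ * Real.log ‖z₀‖ - μ * Real.log ‖t‖) := by rw [hre]; ring
  rw [hsplit]
  have hL := le_abs_self L₀
  have hL' := neg_abs_le L₀
  rw [abs_le] at hdiff hμ ⊢
  constructor <;> linarith [hdiff.1, hdiff.2, hμ.1, hμ.2]

end Summit.Schanuel.Schanuel.Theorems
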